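import Summits.BirchSwinnertonDyer.BirchSwinnertonDyer.Theorems.PrintX10bStubReadoutLocalIndexP
import Literature.NumberTheory.EllipticCurves.ZpExtensionEisensteinReadoutOrdinaryPrincipalProofs
import HarnessLib

/-!
# The registered stub `stub_readoutLocalIndexP : Stmt.readoutLocalIndexP` of the shared μ-crux CLOSED
# (letter (B5-P) of `stub_readoutIndex`, skeleton v9.2 of μ-LEAD `bsd-line-x9-p1` g4 on `MuInequalityCoherentPairOfPrintCG`,
# stmt-BirchSwinnertonDyer-23428; cell `pub/bsd-print-x9`, seat `bsd-line-x10b-p1-w7` g3, S1-DISCRETE lane)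

Summits-side, THEOREMS ONLY (no definition, no named fact, no instance, no `sorry`); ROUTE-INDEPENDENT (no `Theses` import).
One line: this seat's conditional closer `HeegnerMuPartControlGlue.stub_readoutLocalIndexP_of_principalShift`
(`Theorems/PrintX10bStubReadoutLocalIndexP`, p679050 — the `m`-uniform local index at `v ∣ p`: relaxed, level-shifted condition
`Fv := F′.comap (incLocIter j (inr v) d_v)`, `#(Fv ⧸ condA ∩ Fv) ≤ [F′ : core]·[core : core ∩ F_𝔮] ≤ p^{2p^s}`) applied to
x10b-p1-w6 g4's (hS′) theorem `WeierstrassCurve.exists_quotient_cocycle_principal_of_eisensteinTowerReadout_mem_selmerInfty`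
(`Literature/…/ZpExtensionEisensteinReadoutOrdinaryPrincipalProofs`, p678180 — Selmer readout ⇒ after a shift by `d_v` levels the
localisation has graded readout principal on `res⁻¹(ker κ)`; Greenberg strict = (CG) Kummer at `v ∣ p`), whose binder telescope is
the hypothesis `hP` verbatim up to definitional unfolding (`(W.eisensteinTower κ⁻ hm).ρ k = κ⁻.eisensteinTwist E_K[p^{k+1}] hm (k+1)`).
Inputs in the kernel: (δ) p676371, (ε) p675114 (over p674121, p674702), (β) p675869 (over p675601), KER-RES-COUNT p672759/p673740
(this seat); (hS′) p676216/p678180 (x10b-p1-w6 g4, over x9-p2 g6's p675358); letters p675427 (x10b-p1-w2 g11); frame lemmas of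
`PrintX10bStubReadoutSelmer` §1.  HONEST FRAMING: the `v ∣ p` clause of Howard's Lemma 2.2.7/3.2.7 at `𝔮 = T^m + p` with the
honest `m`-UNIFORM count replacing «depending only on `[S_𝔮 : Λ/𝔮]`»; «beyond-print theorem»: the `m`-uniformity (anomalous
`v ∣ p` included) is gap-filling.  BSD is not proved by any of this; no summit statement is proved by this seat.

References: [Howard2004HeegnerKolyvagin] Lemma 2.2.7 / Prop. 2.2.8, Lemma 3.2.7, proof of Thm. 2.2.10 (arXiv:1202.6340 p. 16–18);
[GreenbergLNM1716] §2–§4; [Brink2007] Cor. 1; [MilneADT2006] I Cor. 2.3; [MazurRubinMemoirs2004] Lemma 3.7.1, Prop. 5.3.14.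
-/

set_option linter.dupNamespace false
set_option autoImplicit false

noncomputable section

namespace Summit.BirchSwinnertonDyer.BirchSwinnertonDyer.Theorems.HeegnerMuPartControlGlue

set_option maxHeartbeats 800000 in
/-- **The registered stub (B5-P) `stub_readoutLocalIndexP : Stmt.readoutLocalIndexP` holds**: at the places `v ∣ p`, for
`m ≥ p^s + 1` (`p^s` one exact value of `κ⁻¹` on `Γ_{K_v}` for all `v ∣ p`), every admissible Eisenstein datum and every tower
level `j`, a relaxed local condition `Fv ∋ loc_v c` for every class `c` with readout in `Sel_{p^∞}(E/K_∞)`, with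
`#(Fv ⧸ condA_j(v) ∩ Fv) ≤ p^{2p^s}` — `c := 2p^s` independent of `m`, `j` and the datum.  The conditional closer applied to the
(hS′) theorem (the heartbeat budget pays for the definitional unfolding of Howard's tower of the curve in the binder telescope).
[cite: Howard2004HeegnerKolyvagin, Lemma 2.2.7 / Prop. 2.2.8, Lemma 3.2.7 and proof of Thm. 2.2.10 (𝔮 = T^m + p)]
[cite: GreenbergLNM1716, §2–§4] [cite: Brink2007, Cor. 1] [cite: MilneADT2006, I Cor. 2.3] -/
theorem stub_readoutLocalIndexP : Stmt.readoutLocalIndexP :=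
  stub_readoutLocalIndexP_of_principalShift
    @WeierstrassCurve.exists_quotient_cocycle_principal_of_eisensteinTowerReadout_mem_selmerInfty

end Summit.BirchSwinnertonDyer.BirchSwinnertonDyer.Theorems.HeegnerMuPartControlGlue

end
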